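import Summits.BirchSwinnertonDyer.BirchSwinnertonDyer.Theses.TangentCone
import Literature.NumberTheory.EllipticCurves.NonvanishingTwistsWaldspurgerOfHoffsteinLuo
import Literature.NumberTheory.EllipticCurves.BSDSelmerParityDokchitserMurtyMurtyRemarkTwoProofs
import Literature.NumberTheory.EllipticCurves.HeegnerPoints
import Literature.NumberTheory.EllipticCurves.HalfIntegralWeightForms
import HarnessLib

/-!
# Sketch — crux-ideate round 1 (ideator k = 1) for crux `RankLeOne` (stmt-BirchSwinnertonDyer-17610)

First lemmas of the two idea cards, typed over existing declarations (no new definitions):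

* card `odd-heegner-cut`: the ODD-discriminant supply facts `waldspurger_oddSupply`,
  `murtyMurty_oddSupply` (both PROVED below from the tree's own printed suppliers —
  Hoffstein–Luo 1997 gives `d ≡ 1 (mod 8)`, Murty–Murty 1991 Thm 1 gives `D ≡ 1 (mod 4N)`), and the
  matching classical geometric leaves `gross_zagier_odd` (GZ86 Thm I.6.3 + V.§2, odd `d_K`, NO
  Yuan–Zhang–Zhang / Cai–Shu–Tian) and `kolyvagin_odd` (Gross 1991 Thm 1.3, `D` odd, `D ∉ {-3,-4}`).
* card `jacobi-supply`: `halfIntegralAvatarSupply` (non-vanishing of fundamental coefficients of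
  the weight-3/2 avatar of `f_E` in Waldspurger's space, typed with the tree's `shimuraSubspace`)
  and the supply OUTPUT `gkz_nonTorsionSupply` (an odd Heegner field with NON-TORSION Heegner
  point for `w(E) = -1`, `L'(E,1) ≠ 0`, to be proved from Skoruppa–Zagier + Gross–Kohnen–Zagier
  cross heights, with no twisted `L`-value ever estimated).
-/

set_option linter.dupNamespace false

namespace Summit.BirchSwinnertonDyer.BirchSwinnertonDyer.Cruxes.RankLeOne.IdeaSketchK1

open Summit.BirchSwinnertonDyer.BirchSwinnertonDyer.Theses.TangentCone (RankLeOne)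
open Literature.NumberTheory.EllipticCurves Literature.NumberTheory.EllipticCurves.ModularForms
open scoped UpperHalfPlane Classical

/-! ## Card A — `odd-heegner-cut` -/

/-- **(Wa-odd)** Waldspurger/Hoffstein–Luo supply with ODD discriminant (`d_K ≡ 1 (mod 8)`):
for `w(E) = -1`, every bound `B`, an imaginary quadratic Heegner field `K` for `N_E`,
`|d_K| > B`, `d_K ≡ 1 (mod 8)`, `L(E^{(d_K)}, 1) ≠ 0`. -/
def waldspurger_oddSupply : Prop :=
  ∀ (W : WeierstrassCurve ℚ) [W.IsElliptic], W.rootNumber = -1 → ∀ B : ℕ,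
    ∃ (K : Type) (_ : Field K) (_ : NumberField K),
      IsImaginaryQuadratic K ∧ B < (NumberField.discr K).natAbs ∧
        SatisfiesHeegnerHypothesis (W.conductorNorm ℤ) K ∧
          (NumberField.discr K % 8 = 1 ∧
            (W.quadraticTwist (NumberField.discr K : ℚ)).entireLFunction 1 ≠ 0)

/-- **(MM-odd)** Murty–Murty supply (Remark-1 form) with ODD discriminant (`d_K ≡ 1 (mod 4)`):
for `w(E) = +1`, every `B`, a Heegner field `K` for `N_E`, `|d_K| > B`, `d_K ≡ 1 (mod 4)`,
`L(E^{(d_K)}, s)` with a simple zero at `s = 1`. -/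
def murtyMurty_oddSupply : Prop :=
  ∀ (W : WeierstrassCurve ℚ) [W.IsElliptic], W.rootNumber = 1 → ∀ B : ℕ,
    ∃ (K : Type) (_ : Field K) (_ : NumberField K),
      IsImaginaryQuadratic K ∧ B < (NumberField.discr K).natAbs ∧
        SatisfiesHeegnerHypothesis (W.conductorNorm ℤ) K ∧
          (NumberField.discr K % 4 = 1 ∧
            (W.quadraticTwist (NumberField.discr K : ℚ)).entireLFunction 1 = 0 ∧
              deriv (W.quadraticTwist (NumberField.discr K : ℚ)).entireLFunction 1 ≠ 0)

/-- **(GZ-odd)** the Gross–Zagier formula under GZ86's OWN standing hypothesis `d_K` odd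
(Gross–Zagier 1986, I.§3 "D odd", Thm I.6.3, V.§2; YZZ 2013 §1.1 p. 5: "Assume that K has an odd
fundamental discriminant D, and satisfies the Heegner condition"). No Cai–Shu–Tian / YZZ needed. -/
def gross_zagier_odd (N : ℕ) [NeZero N] (W : WeierstrassCurve ℚ) (K : Type) [Field K]
    [NumberField K] : Prop :=
  ∀ [W.IsElliptic], IsImaginaryQuadratic K → SatisfiesHeegnerHypothesis N K →
    Odd (NumberField.discr K) → GrossZagierFormula N W K

/-- **(Ko-odd)** Kolyvagin's Theorem A in Gross 1991's printed setting: `D` odd, `D ∉ {-3, -4}`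
(so `𝓞_K^× = {±1}`), Heegner hypothesis, `y_K` of infinite order ⇒ `rank E(K) = 1 ∧ #Ш(E/K) < ∞`. -/
def kolyvagin_odd (N : ℕ) [NeZero N] (W : WeierstrassCurve ℚ) (K : Type) [Field K]
    [NumberField K] : Prop :=
  ∀ [W.IsElliptic], IsImaginaryQuadratic K → SatisfiesHeegnerHypothesis N K →
    Odd (NumberField.discr K) → 4 < (NumberField.discr K).natAbs →
      ∀ {P : (W.baseChange K).toAffine.Point}, IsHeegnerPoint N W K P → ¬ IsOfFinAddOrder P →
        (W.baseChange K).mordellWeilRank = 1 ∧ (W.baseChange K).ShaFinite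

/-- The intended composition of line `odd-heegner-cut` (a `Prop`, to be PROVED by the lead by
re-threading the tree assembly
`rank_eq_analyticRank_of_analyticRank_le_one_of_nonempty_modularParametrizationData` with the
oddness / `|d_K| > 4` hypotheses — every internal step of that assembly is `K`-pointwise). -/
def OddCutComposition : Prop :=
  exists_isNewformOf → waldspurger_oddSupply → murtyMurty_oddSupply →
    (∀ (N : ℕ) [NeZero N] (W : WeierstrassCurve ℚ) (K : Type) [Field K] [NumberField K],
      gross_zagier_odd N W K) →
    (∀ (N : ℕ) [NeZero N] (W : WeierstrassCurve ℚ) (K : Type) [Field K] [NumberField K],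
      kolyvagin_odd N W K) → RankLeOne

/-- **First lemma of card A, PROVED**: the odd Waldspurger supply from the Modularity Theorem and
Hoffstein–Luo 1997 — the SAME proof as the tree's
`waldspurger_exists_heegnerField_twist_ne_zero_of_hoffsteinLuo`, keeping the conjunct
`d ≡ 1 (mod 8)` that the tree's packaging discards. -/
theorem waldspurger_oddSupply_of_hoffsteinLuo (hmod : exists_isNewformOf)
    (hHL : HoffsteinLuo1997_exists_twist_L_one_ne_zero) : waldspurger_oddSupply := by
  intro W _ hw B
  obtain ⟨d, hdneg, hsq, hd8, hBd, -, hjacN, hL⟩ :=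
    exists_neg_fundamental_twist_ne_zero_of_hoffsteinLuo hmod hHL W hw ∅ B
  exact (exists_heegnerField_iff_exists_fundamental (W.conductorNorm ℤ) B
      (fun D ↦ D % 8 = 1 ∧ (W.quadraticTwist (D : ℚ)).entireLFunction 1 ≠ 0)).mpr
    ⟨d, hdneg, Or.inl ⟨by omega, hsq, by omega⟩, hBd,
      fun p hp hpN ↦ ⟨fun _ ↦ hd8, fun hp2 ↦ hjacN p hp hpN hp2⟩, hd8, hL⟩

/-- **First lemma of card A (rank-0 half), PROVED**: the odd Murty–Murty supply from the
Modularity Theorem and the non-vanishing output of Murty–Murty 1991 Thm 1 (first moment of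
`L'_D(1)` over `D ≡ 1 (mod 4N)`) — the SAME proof as the tree's
`murtyMurty_exists_heegnerField_twist_simpleZero_of_rootNumber_eq_one_of_exists_deriv_ne_zero`,
keeping `D ≡ 1 (mod 4)`. -/
theorem murtyMurty_oddSupply_of_exists_deriv_ne_zero (hmod : exists_isNewformOf)
    (h : ∀ (W : WeierstrassCurve ℚ) [W.IsElliptic], W.rootNumber = 1 → ∀ B : ℕ,
      ∃ D : ℤ, D < 0 ∧ Squarefree D ∧ D ≡ 1 [ZMOD 4 * (W.conductorNorm ℤ : ℤ)] ∧
        B < D.natAbs ∧ deriv (W.quadraticTwist (D : ℚ)).entireLFunction 1 ≠ 0) :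
    murtyMurty_oddSupply := by
  intro W _ hw B
  obtain ⟨D, hD0, hsq, hD, hB, hL1⟩ := h W hw B
  obtain ⟨hD4, h8, hjac⟩ := kronecker_eq_one_of_modEq_one hD
  have hL0 : (W.quadraticTwist (D : ℚ)).entireLFunction 1 = 0 :=
    entireLFunction_quadraticTwist_one_eq_zero_of_modEq hmod W hw hD0 hsq hD
  exact (exists_heegnerField_iff_exists_fundamental (W.conductorNorm ℤ) B
    (fun D ↦ D % 4 = 1 ∧ (W.quadraticTwist (D : ℚ)).entireLFunction 1 = 0 ∧
      deriv (W.quadraticTwist (D : ℚ)).entireLFunction 1 ≠ 0)).mpr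
    ⟨D, hD0, Or.inl ⟨hD4, hsq, (hD0.trans zero_lt_one).ne⟩, hB,
      fun p hp hpN ↦ ⟨fun hp2 ↦ h8 (hp2 ▸ hpN), fun hp2 ↦ hjac p hp hpN hp2⟩, hD4, hL0, hL1⟩

/-- Sanity: the odd supplies imply the tree's (Wa) and (MM, Remark-1 form) verbatim (drop the
congruence), so nothing downstream is lost. -/
theorem waldspurger_of_oddSupply (h : waldspurger_oddSupply) :
    waldspurger_exists_heegnerField_twist_ne_zero := by
  intro W _ hw B
  obtain ⟨K, _, _, hK, hB, hH, -, hL⟩ := h W hw B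
  exact ⟨K, _, _, hK, hB, hH, hL⟩

theorem murtyMurty_of_oddSupply (h : murtyMurty_oddSupply) :
    murtyMurty_exists_heegnerField_twist_simpleZero_of_rootNumber_eq_one := by
  intro W _ hw B
  obtain ⟨K, _, _, hK, hB, hH, -, hL0, hL1⟩ := h W hw B
  exact ⟨K, _, _, hK, hB, hH, hL0, hL1⟩

/-- Sanity: the tree's all-`d_K` leaves imply the odd leaves (the cut only WEAKENS (GZ), (Ko)). -/
theorem gross_zagier_odd_of_gross_zagier (N : ℕ) [NeZero N] (W : WeierstrassCurve ℚ) (K : Type)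
    [Field K] [NumberField K] (h : gross_zagier N W K) : gross_zagier_odd N W K :=
  fun hK hH _ ↦ h hK hH

theorem kolyvagin_odd_of_kolyvagin (N : ℕ) [NeZero N] (W : WeierstrassCurve ℚ) (K : Type)
    [Field K] [NumberField K] (h : kolyvagin N W K) : kolyvagin_odd N W K :=
  fun hK hH _ _ _ hP hnt ↦ h hK hH hP hnt

/-! ## Card B — `jacobi-supply` -/

/-- **(Av)** the weight-`3/2` avatar supplies the discriminants: for `E/ℚ` (globally minimal `W`,
conductor `N`) with `w(E) = -1` there are a level `N'` with `N ∣ N'` and a form `g` in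
Waldspurger's space `S_{3/2}(4N', 1, f_E)` (tree `shimuraSubspace`, eigenvalues `a_p(E)`) whose
`q`-coefficients are non-zero at `|D|` for INFINITELY MANY odd fundamental `D < 0`,
`D ≡ 1 (mod 8)`, with every odd prime of `N` split in `ℚ(√D)` (Kohnen 1982/1985 for `N` odd
square-free via the plus newform; Skoruppa–Zagier 1988 / Gross–Kohnen–Zagier 1987 Jacobi newform
of index `N` in general; infinitude of non-zero FUNDAMENTAL coefficients: Vignéras 1977 /
Serre–Stark-type finiteness + Hecke + Hasse bound). -/
def halfIntegralAvatarSupply : Prop :=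
  ∀ (W : WeierstrassCurve ℚ) [W.IsElliptic] [W.IsGloballyMinimal], W.rootNumber = -1 →
    ∃ (N' : ℕ) (g : ℍ → ℂ), W.conductorNorm ℤ ∣ N' ∧
      g ∈ shimuraSubspace 3 (4 * N') 1 (fun p ↦ (W.frobeniusTrace p : ℂ)) ∧
        Set.Infinite {D : ℤ | D < 0 ∧ Squarefree D ∧ D % 8 = 1 ∧
          (∀ p : ℕ, p.Prime → p ∣ W.conductorNorm ℤ → p ≠ 2 → jacobiSym D p = 1) ∧
            qCoeffs g D.natAbs ≠ 0}

/-- **(GKZ-out)** the OUTPUT of the Gross–Kohnen–Zagier supply, replacing (Wa)∘(GZ) in the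
`r_an = 1` half: for `w(E) = -1` and `L'(E, 1) ≠ 0` there is an ODD Heegner field `K` for `N_E`
with `|d_K| > 4` whose Heegner point `P_K ∈ E(K)` has infinite order — obtained from two avatar
coefficients `c(D₀) c(D₁) ≠ 0` and the cross-height formula
`⟨y_{D₀}, y_{D₁}⟩_E = L'(E,1) c(D₀) c(D₁) / (4π ‖φ_E‖²)` (GKZ 1987, Math. Ann. 278; Zagier ICM
1986 Thm 2 and Corollary), never through a value `L(E^{(D)}, 1)`. -/
def gkz_nonTorsionSupply : Prop :=
  ∀ (W : WeierstrassCurve ℚ) [W.IsElliptic] [W.IsGloballyMinimal] [NeZero (W.conductorNorm ℤ)],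
    W.rootNumber = -1 → deriv W.entireLFunction 1 ≠ 0 →
      ∃ (K : Type) (_ : Field K) (_ : NumberField K),
        IsImaginaryQuadratic K ∧ SatisfiesHeegnerHypothesis (W.conductorNorm ℤ) K ∧
          Odd (NumberField.discr K) ∧ 4 < (NumberField.discr K).natAbs ∧
            ∃ P : (W.baseChange K).toAffine.Point,
              IsHeegnerPoint (W.conductorNorm ℤ) W K P ∧ ¬ IsOfFinAddOrder P

/-- The intended composition of line `jacobi-supply`: the `r_an = 1` half from (M), (GKZ-out),
(Ko-odd); the `r_an = 0` half as in card A ((MM-odd), (GZ-odd), (Ko-odd)). A `Prop` for the lead. -/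
def JacobiSupplyComposition : Prop :=
  exists_isNewformOf → gkz_nonTorsionSupply → murtyMurty_oddSupply →
    (∀ (N : ℕ) [NeZero N] (W : WeierstrassCurve ℚ) (K : Type) [Field K] [NumberField K],
      gross_zagier_odd N W K) →
    (∀ (N : ℕ) [NeZero N] (W : WeierstrassCurve ℚ) (K : Type) [Field K] [NumberField K],
      kolyvagin_odd N W K) → RankLeOne

end Summit.BirchSwinnertonDyer.BirchSwinnertonDyer.Cruxes.RankLeOne.IdeaSketchK1
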